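import Mathlib
import Summits.MatrixMultiplication.MatrixMultiplication.Theses.FidelityWitnesses
import Summits.MatrixMultiplication.MatrixMultiplication.Theorems.FidelityThesis.Negative.SummitEquivalence
import Literature.Computability.AlgebraicComplexity.CohnUmansTPPProofs

/-!
# StrategistSketch2 — typed companion of STRATEGY-CENSUS.md, gen-1 addendum (crux stmt-MatrixMultiplication-4956)

Every decomposition ATTEMPTED in the gen-1 addendum and NOT filed is typed here (elaboration only; the one
filed decomposition lives in `Lines/scc_dark_host.lean`).  Notation: `M(n,r)`-type fidelity quantities are
inlined as in the route file; `φ(n) := M(n,n²)/n³` is the diagonal captured fraction.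

* §M1  method-completeness cut {`GroupsCapped`, `GroupsUniversal`} with its 4-line assembly
  (`crux_of_groupsCapped_groupsUniversal`) — shows concretely why it fails (b) (transitivity seam) although it
  passes (a),(c); and `groupsCapped_of_crux` (the piece is a CONSEQUENCE of the crux via the deep tree theorem
  `CKSU2005_thm18_holds`).
* §Φ   fidelity-native cut {`DiagonalDecay`, `DiagonalSubmultiplicativity`} — typed; rejected for plausibility
  (DRIFT), not for (a)(b)(c).
* §W   {`BorderRankSuperFormat`, `OmegaAttainedWithinConstant`} — typed; the second piece is undecidable without
  deciding `ω` in BOTH directions.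
* §Z   {`UniformDiagonalGap`, `ConverseDefectLaw κ`} — typed; `κ < 1` is a superquadratic border-rank bound in
  disguise once the (provable) gap lands.
-/

set_option linter.dupNamespace false

namespace Summit.MatrixMultiplication.MatrixMultiplication.Cruxes.FidelityThesis.Strategist2

open scoped BigOperators
open Literature.Computability.AlgebraicComplexity
open Literature.RepresentationTheory.FiniteGroups
open Summit.MatrixMultiplication.MatrixMultiplication.Theses.FidelityWitnesses (FidelityThesis)
open Summit.MatrixMultiplication.MatrixMultiplication.Theorems
  (omega_le_two_of_not_fidelityThesis two_lt_omega_of_fidelityThesis)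

/-! ## §M1 — method completeness: "groups are capped away from 2" ∧ "groups achieve ω" -/

/-- A finite group CERTIFIES exponent `τ` (in the Cohn–Umans currency of CKSU Thm 1.8): some TPP realization
`⟨n,m,p⟩ ≤ ℂ[G]` has `Σᵢ dᵢ^τ < (nmp)^{τ/3}` (so, by Thm 1.8 and convexity, `ω < τ` whenever `τ ≤ 3`). -/
def GroupCertifies (τ : ℝ) : Prop :=
  ∃ (G : Type) (_ : Group G) (_ : Finite G) (n m p : ℕ), RealizesTPP G n m p ∧
    charDegreePowSum G τ < ((n * m * p : ℕ) : ℝ) ^ (τ / 3)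

/-- GC — THE GROUP-THEORETIC APPROACH IS CAPPED: some `η ∈ (0,1]` is certified by no finite group. -/
def GroupsCapped : Prop := ∃ η : ℝ, 0 < η ∧ η ≤ 1 ∧ ¬ GroupCertifies (2 + η)

/-- GU — THE GROUP-THEORETIC APPROACH IS UNIVERSAL: every exponent in `(ω, 3]` is certified by some group
(the ω-agnostic form of Cohn–Umans' "groups/commutative coherent configurations suffice", CU 2013 §1, conjectured). -/
def GroupsUniversal : Prop := ∀ τ : ℝ, omega ℂ < τ → τ ≤ 3 → GroupCertifies τ

/-- The assembly of §M1 is FOUR LINES — a transitivity seam (`ω ≥ ω_grp > 2`): this is why M1 is recorded,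
not filed (criterion (b)). [folklore] -/
theorem crux_of_groupsCapped_groupsUniversal (hGC : GroupsCapped) (hGU : GroupsUniversal) : FidelityThesis := by
  obtain ⟨η, hη, hη1, hnc⟩ := hGC
  by_contra hX
  have hω : omega ℂ ≤ 2 := omega_le_two_of_not_fidelityThesis hX
  exact hnc (hGU (2 + η) (by linarith) (by linarith))

/-- GC is a CONSEQUENCE of the crux (through the deep tree theorem CKSU Thm 1.8): if `ω = 2 + η₀ > 2` then no
group certifies `2 + min η₀ 1`… stated simply: the crux gives `¬ GroupCertifies (ω)` and `ω ∈ (2, 3]`. [cite: CohnKleinbergSzegedyUmans2005, Thm. 1.8] -/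
theorem not_groupCertifies_omega : ¬ GroupCertifies (omega ℂ) := by
  rintro ⟨G, _, _, n, m, p, hTPP, hlt⟩
  exact absurd (CKSU2005_thm18_holds G n m p hTPP) (not_le.2 hlt)

/-- … hence `FidelityThesis → GroupsCapped` as soon as `ω ≤ 3` (tree: `omega_le_three'`): take `η := ω − 2`. -/
theorem groupsCapped_of_crux (hX : FidelityThesis) : GroupsCapped := by
  have h2 := two_lt_omega_of_fidelityThesis hX
  have h3 : omega ℂ ≤ 3 := omega_le_three' (K := ℂ)
  refine ⟨omega ℂ - 2, by linarith, by linarith, ?_⟩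
  rw [show 2 + (omega ℂ - 2) = omega ℂ by ring]
  exact not_groupCertifies_omega

/-- The smell: GU is implied by ¬GC (outside the GC-world GU is vacuous). [folklore] -/
theorem groupsUniversal_of_not_groupsCapped (h : ¬ GroupsCapped) : GroupsUniversal := by
  intro τ hτ hτ3
  by_contra hc
  have h2 := omega_two_le (K := ℂ)
  exact h ⟨τ - 2, by linarith, by linarith, by rw [show 2 + (τ - 2) = τ by ring]; exact hc⟩

/-! ## §Φ — fidelity-native: qualitative diagonal decay ∧ sub-multiplicativity of the diagonal capture -/

/-- `Capture n B`: every rank-`≤ n²` tensor captures at most `B` (squared overlap) of `⟨n,n,n⟩`, i.e. `M(n,n²) ≤ B`. -/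
def Capture (n : ℕ) (B : ℝ) : Prop :=
  ∀ S : Fin n × Fin n → Fin n × Fin n → Fin n × Fin n → ℂ, tensorRank S ≤ n ^ 2 →
    ‖∑ a, ∑ b, ∑ c, S a b c * matMulTensor ℂ n n n a b c‖ ^ 2 ≤ B * ∑ a, ∑ b, ∑ c, ‖S a b c‖ ^ 2

/-- Y₁ — QUALITATIVE DIAGONAL DECAY `φ(n) → 0`: for every `ε > 0`, eventually `M(n,n²) ≤ ε n³`.  Incomparable
with the crux as far as known (`ω = 2` allows `φ ≥ n^{-o(1)} → 0`; `ω > 2` gives no capture bound). -/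
def DiagonalDecay : Prop := ∀ ε : ℝ, 0 < ε → ∃ N : ℕ, ∀ n : ℕ, N ≤ n → Capture n (ε * (n : ℝ) ^ 3)

/-- Y₂ — SUB-MULTIPLICATIVITY OF THE DIAGONAL CAPTURE up to a constant: `M(ab,(ab)²) ≤ C·M(a,a²)·M(b,b²)`-type,
in the one-sided form the Fekete argument needs: a capture bound at `a` and at `b` give one at `ab`.
REJECTED (drift): false unless `ω` is attained within constants along every scale. -/
def DiagonalSubmultiplicativity : Prop :=
  ∃ C : ℝ, 0 < C ∧ ∀ (a b : ℕ) (A B : ℝ), 0 ≤ A → 0 ≤ B → Capture a A → Capture b B →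
    Capture (a * b) (C * A * B)

/-! ## §W — super-format border rank ∧ "ω attained within a constant" -/

/-- W₂ — `R̲(⟨n,n,n⟩)/n² → ∞` (the weakest unknown consequence of the crux in border-rank currency; beyond the
cactus cap `6n² − 4` of every linear method, yet NOT known to imply `ω > 2`: drift). -/
def BorderRankSuperFormat : Prop :=
  ∀ A : ℝ, ∃ N : ℕ, ∀ n : ℕ, N ≤ n → A * (n : ℝ) ^ 2 < (algBorderRank (matMulTensor ℂ n n n) : ℝ)

/-- W₁ — `ω` IS ATTAINED WITHIN A CONSTANT in border rank: `R̲(⟨n,n,n⟩) ≤ C n^ω`.  With W₂ it gives `ω > 2`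
(`C n² < … ≤ C n^ω`), but it can be neither proved nor refuted without deciding `ω` (REJECTED: unknowable both ways). -/
def OmegaAttainedWithinConstant : Prop :=
  ∃ C : ℝ, ∀ n : ℕ, 1 ≤ n → (algBorderRank (matMulTensor ℂ n n n) : ℝ) ≤ C * (n : ℝ) ^ omega ℂ

/-- The W-assembly (genuine but short): W₂ ∧ W₁ ⟹ crux. [folklore] -/
theorem crux_of_W (h₂ : BorderRankSuperFormat) (h₁ : OmegaAttainedWithinConstant) : FidelityThesis := by
  obtain ⟨C, hC⟩ := h₁
  by_contra hX
  have hω : omega ℂ ≤ 2 := omega_le_two_of_not_fidelityThesis hX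
  obtain ⟨N, hN⟩ := h₂ C
  have hup := hC (N + 1) (by omega)
  have hlow := hN (N + 1) (by omega)
  have h := hlow.trans_le hup
  have hn1 : (1 : ℝ) ≤ ((N + 1 : ℕ) : ℝ) := by exact_mod_cast Nat.succ_le_succ (Nat.zero_le N)
  have hnpos : (0 : ℝ) < ((N + 1 : ℕ) : ℝ) := by positivity
  have hpow : ((N + 1 : ℕ) : ℝ) ^ omega ℂ ≤ ((N + 1 : ℕ) : ℝ) ^ (2 : ℝ) :=
    Real.rpow_le_rpow_of_exponent_le hn1 hω
  rw [Real.rpow_two] at hpow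
  have hωpos : 0 < ((N + 1 : ℕ) : ℝ) ^ omega ℂ := Real.rpow_pos_of_pos hnpos _
  have hbR0 : (0 : ℝ) ≤ (algBorderRank (matMulTensor ℂ (N + 1) (N + 1) (N + 1)) : ℝ) := Nat.cast_nonneg _
  have hCn : 0 ≤ C * ((N + 1 : ℕ) : ℝ) ^ omega ℂ := hbR0.trans hup
  rcases lt_trichotomy C 0 with hneg | hzero | hpos
  · nlinarith
  · subst hzero
    simp at h
  · nlinarith [mul_le_mul_of_nonneg_left hpow hpos.le]

/-! ## §Z — uniform diagonal gap ∧ converse defect law with slack `n^κ` -/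

/-- Z₁ — UNIFORM DIAGONAL GAP: one `ε > 0` with `M(n,n²) ≤ (1−ε) n³` for all `n ≥ 1` (plausibly PROVABLE by an
equivariant Koszul-flattening witness, captured fraction → 1/2; does not imply `ω > 2`). -/
def UniformDiagonalGap : Prop := ∃ ε : ℝ, 0 < ε ∧ ∀ n : ℕ, 1 ≤ n → Capture n ((1 - ε) * (n : ℝ) ^ 3)

/-- Z₂(κ) — CONVERSE DEFECT LAW with slack `n^κ` at the diagonal: `n³ − M(n,n²) ≤ C n^κ (R̲(⟨n,n,n⟩) − n²)`,
written as: every capture bound `B` valid at `(n, n²)` satisfies `n³ − B ≤ C n^κ (R̲ − n²)`.  With Z₁ it gives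
`R̲ ≥ n² + ε n^{3−κ}/C`, superquadratic iff `κ < 1` — i.e. Z₂(κ<1) IS a superquadratic border-rank bound modulo the
provable Z₁ (REJECTED: costume once Z₁ lands); Z₂(0) ∧ Z₁ would give `ω = 3` (absurd: Z₂(0) is false). -/
def ConverseDefectLaw (κ : ℝ) : Prop :=
  ∃ C : ℝ, 0 < C ∧ ∀ n : ℕ, 1 ≤ n → ∀ B : ℝ, Capture n B →
    (n : ℝ) ^ 3 - B ≤ C * (n : ℝ) ^ κ * ((algBorderRank (matMulTensor ℂ n n n) : ℝ) - (n : ℝ) ^ 2)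

end Summit.MatrixMultiplication.MatrixMultiplication.Cruxes.FidelityThesis.Strategist2
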